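import Mathlib
import Summits.ValiantsHypothesis.ValiantsHypothesis.Theses.FreeSubtorus
import Summits.ValiantsHypothesis.ValiantsHypothesis.Theorems.FreeSubtorusSubtorusCovering
import Summits.ValiantsHypothesis.ValiantsHypothesis.Cruxes.OrbitDimensionBound.Lines.ConfusionLadder
import Summits.ValiantsHypothesis.ValiantsHypothesis.Cruxes.OrbitDimensionBound.Lines.GaugeLadder
import Literature.Computability.AlgebraicComplexity.EquivariantDC
import Literature.Computability.AlgebraicComplexity.DetReprEquivalent
import Literature.Computability.AlgebraicComplexity.GrenetEquivariant
import Literature.Computability.AlgebraicComplexity.BlockDecomposable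
import Literature.Computability.AlgebraicComplexity.PBoundedGrowth

/-!
# `DepthLadder` — the DEGENERATION-DEPTH family through the PROVED floor `SubtorusCovering`
# (crux dir of stmt-ValiantsHypothesis-16133 `OrbitDimensionBound`, route FreeSubtorus; forward rung G1 gen 9, sorry-free)

FLOOR (seed g1-ValiantsHypothesis-16134, landed):
`Summit.ValiantsHypothesis.ValiantsHypothesis.Theorems.FreeSubtorusSubtorusCovering.subtorusCovering_proof :
 Theses.FreeSubtorus.SubtorusCovering` — for `n ≥ 3`, an affine determinantal representation `A` of `per_n` of size `m` with
EXACT CONSTANT lifts of an admissibly cut subtorus `T_Λ` (`r` generators; `A(γ·x) = g · A(x) · h⁻¹`, `g, h ∈ GL_m(ℂ)`) has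
`C(n, ⌊n/2⌋) ≤ m · 2^r`.

THE ONE MOVE (hypothesis H4, the EXACTNESS of the lift, generalised toward the symmetry-free Statement).  The floor asks
`A(γ·x)` to lie IN the constant gauge orbit `GL_m(ℂ) · A · GL_m(ℂ)`.  The rung asks it only UP TO ONE-PARAMETER DEGENERATION:
`A(γ·x)` and `A(x)` have a COMMON LIMIT `B = lim_{t→0} diag(t^{a}) · P X Q · diag(t^{-b})` (`X = A`, resp. `X = A(γ·x)`), along
determinant-preserving one-parameter subgroups of the gauge group (`Σ a = Σ b`).  Such a limit exists iff the gauge form `P X Q`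
is block-LOWER-triangular for the weights (`(PXQ)_{ij} = 0` when `a_i < b_j`) and then equals its weight-DIAGONAL part
(`weightTruncate a b`): in module language, `B ≅ gr_F(X)` is the associated graded of a finite filtration `F` of the matrix pencil
`X` by sub-pencils `(V_ℓ, W_ℓ)` of EQUAL dimensions (the subobjects in King's abelian category of `θ`-semistable Kronecker
modules, `θ = (-1,1)`; a pencil with `det ≢ 0` is `θ`-semistable).  The dial is the DEPTH `q ∈ ℕ∞` = the weight budget
`a_i, b_j ≤ q`:

* `q = 0`: all weights `0`, the "limit" is the gauge form itself — LITERALLY the floor's exact-lift condition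
  (`depthLifts_zero_iff`, `depthCovering_zero_iff : DepthCovering 0 ↔ SubtorusCovering`, `depthCovering_zero` = the seed);
* `q = 1`: two weight levels — `A(γ·x)` and `A(x)` agree after ONE-STEP SEMISIMPLIFICATION (block-diagonalising each along one
  equal-dimension sub-pencil): THE RUNG `FilteredCovering := DepthCovering 1` ("lifts modulo a one-step filtration");
* `q = ⊤`: arbitrary finite filtrations — `A(γ·x)` and `A(x)` have isomorphic Jordan–Hölder semisimplifications
  (`PolystableCovering := DepthCovering ⊤`); by Hilbert–Mumford/King this is the invariant-theoretic level "the classes of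
  `A(γ·x)` and `A(x)` in `Rep_m // S(GL_m²)` are related", i.e. the hypothesis of the host route's support item
  `PolystableSeparation` and of line `birth`'s stubs 2–3 — reached here WITHOUT invariant theory;
* the family is ANTITONE in `q` (`DepthCovering.anti`), every member implies the floor (`subtorusCovering_of_depthCovering`);
* where the Statement sits: strictly ABOVE the top — `q = ⊤` still asks the SEMISIMPLIFICATION of `A` to be `T_Λ`-symmetric;
  the Statement asks nothing.  The dial exhausts the notion "symmetric up to degeneration inside the gauge orbit closure";
  the next weakening (symmetry of rank loci / rational gauge) is vacuous or frontier-hard (see the line card).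

WHY THE RUNG IS NOT A COROLLARY OF THE FLOOR (located break).  The floor's engine
(`Theorems.BorderApolarityToricWitnessObstructionQP.stub_torusBound` inside `subtorusCovering_proof`) GRADES `ℂ^m` by the
eigenspaces of an actual lift pair `(g, h)` of one generic torus element and counts levels; a degenerate lift provides no
endomorphism of `ℂ^m` at all — only an isomorphism between associated gradeds of two DIFFERENT filtrations of two different
pencils.  The repair is a new object on this crux: the POLYSTABLE MODEL `gr_JH(A)` (Jordan–Hölder in King's abelian category of
semistable pencils): it has the same size `m`, is again an affine representation of `per_n` (`det` is constant along
determinant-preserving degenerations: `det_weightTruncate`, PROVED here), and — by JH UNIQUENESS — is EXACTLY `γ`-equivariant as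
soon as `A(γ·x)` and `A` have a common degeneration (`gr_JH(A(γ·x)) = γ ⋆ gr_JH(A)` by functoriality, PROVED here as
`IsDegeneration.linSubstEntries` / `IsDegenerationClosed.linSubstEntries`).  So the whole dial follows from two pencil-theoretic
stubs (JH existence = a degeneration-closed model; JH uniqueness = transport along common degenerations) and the floor BY NAME —
skeleton `Lines/filtered_covering.lean`.

ASYMPTOTIC SHADOW / ON-PATH.  `DepthShadow q`: along any sequence of admissible `Λ_n` and affine representations `A_n` of
`per_n` of sizes `m_n` with depth-`q` lifts of the generators of `T_{Λ_n}`, `n ↦ m_n · 2^{r_n}` is not p-bounded.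
`depthShadow_of_summit : ValiantsHypothesis → DepthShadow q` for EVERY `q` (only `dc(per_n) ≤ m_n` is used), tagged `aesop` safe
at the rung `FilteredShadow := DepthShadow 1`; `depthShadow_zero_iff : DepthShadow 0 ↔ CoveringShadow powLoss` (gen 1's floor shadow).

HOW THE RUNG SERVES THE OPEN CRUX `OrbitDimensionBound` (stmt-16133).  The symmetrisation target relaxes to `OrbitDepthBound q`:
re-realise an optimal expression at the same size by a `B` whose class is `T_Λ`-fixed only MODULO DEPTH-`q` DEGENERATION
(`r ≤ n/2`, `Λ` admissible) — the symmetriser may output a NON-polystable matrix whose symmetry is visible only on an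
associated graded (exactly what limit procedures produce); `closes_depth : OrbitDepthBound q → DepthCovering q → VH`,
`orbitDepthBound_of_orbitDimensionBound : OrbitDimensionBound → OrbitDepthBound q`.

Informal sources: exact lifts and `edc` [cite: LandsbergRessayre2017, Def. 1.3, Thm. 2.8, Question 2.2]; one-parameter
degenerations and the semistable/stable dichotomy for quiver representations (King's `θ`-stability, Jordan–Hölder in the
abelian category of semistables) [cite: King1994, Prop. 3.1, Thm. 4.1]; closed orbits reached by one-parameter subgroups
[cite: KempfNess1979]; [cite: MumfordFogartyKirwan1994, Ch. 1 §2, Ch. 2 §1].  Everything in this file is PROVED (no `sorry`).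
-/

set_option linter.dupNamespace false

namespace Summit.ValiantsHypothesis.ValiantsHypothesis.Cruxes.OrbitDimensionBound.Depth

open Matrix MvPolynomial
open Literature.Computability.AlgebraicComplexity
open Summit.ValiantsHypothesis.ValiantsHypothesis.Cruxes.OrbitDimensionBound.Confusion
open Summit.ValiantsHypothesis.ValiantsHypothesis.Cruxes.OrbitDimensionBound.Gauge

noncomputable section

/-! ## §1 One-parameter degenerations of a square matrix (weight truncation of a gauge form) -/

section Truncate

variable {R : Type*} {m : ℕ}

/-- The WEIGHT-DIAGONAL part of `X` for row weights `a` and column weights `b`: keep `X i j` iff `a i = b j`.  This is the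
`t → 0` limit of `diag(t^{a_i}) · X · diag(t^{-b_j})` when that limit exists (`X i j = 0` for `a i < b j`). [cite: King1994, §2]
[cite: KempfNess1979] -/
def weightTruncate [Zero R] (a b : Fin m → ℕ) (X : Matrix (Fin m) (Fin m) R) : Matrix (Fin m) (Fin m) R :=
  Matrix.of fun i j => if a i = b j then X i j else 0

@[simp] theorem weightTruncate_apply [Zero R] (a b : Fin m → ℕ) (X : Matrix (Fin m) (Fin m) R) (i j : Fin m) :
    weightTruncate a b X i j = if a i = b j then X i j else 0 := rfl

/-- Zero weights truncate nothing. [folklore] -/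
@[simp] theorem weightTruncate_zero [Zero R] (X : Matrix (Fin m) (Fin m) R) :
    weightTruncate (fun _ => 0) (fun _ => 0) X = X := by
  ext i j; simp

/-- Truncation commutes with any entrywise map fixing `0`. [folklore] -/
theorem weightTruncate_map [Zero R] {S : Type*} [Zero S] (f : R → S) (hf : f 0 = 0) (a b : Fin m → ℕ)
    (X : Matrix (Fin m) (Fin m) R) : (weightTruncate a b X).map f = weightTruncate a b (X.map f) := by
  ext i j
  simp only [Matrix.map_apply, weightTruncate_apply]
  split_ifs <;> simp [hf]

/-- **The determinant is constant along a determinant-preserving one-parameter degeneration.**  If the gauge form `X` is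
block-lower-triangular for the weights (`X i j = 0` whenever `a i < b j`) and the one-parameter subgroup lies in `S(GL_m²)`
(`Σ a = Σ b`), then `det (weightTruncate a b X) = det X`: in the Leibniz expansion a permutation `σ` either meets an entry with
`a (σ i) < b i` (both products vanish) or has all `a (σ i) ≥ b i`, whence — the sums being equal — all `a (σ i) = b i` and the two
products coincide termwise. [folklore] -/
theorem det_weightTruncate [CommRing R] (a b : Fin m → ℕ) (X : Matrix (Fin m) (Fin m) R)
    (hs : ∑ i, a i = ∑ j, b j) (hz : ∀ i j, a i < b j → X i j = 0) :
    (weightTruncate a b X).det = X.det := by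
  rw [Matrix.det_apply, Matrix.det_apply]
  refine Finset.sum_congr rfl fun σ _ => ?_
  congr 1
  by_cases hall : ∀ i, a (σ i) = b i
  · exact Finset.prod_congr rfl fun i _ => by simp [hall i]
  · push Not at hall
    obtain ⟨i₀, hi₀⟩ := hall
    have hL : (∏ i, weightTruncate a b X (σ i) i) = 0 :=
      Finset.prod_eq_zero (Finset.mem_univ i₀) (by simp [hi₀])
    have hR : (∏ i, X (σ i) i) = 0 := by
      by_contra hne
      have hge : ∀ i, b i ≤ a (σ i) := by
        intro i
        by_contra hlt
        push Not at hlt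
        exact hne (Finset.prod_eq_zero (Finset.mem_univ i) (hz _ _ hlt))
      have hsum : ∑ i, b i = ∑ i, a (σ i) := by
        rw [Equiv.sum_comp σ a]; exact hs.symm
      have heq : ∀ i ∈ Finset.univ, b i = a (σ i) :=
        (Finset.sum_eq_sum_iff_of_le fun i _ => hge i).mp hsum
      exact hi₀ (heq i₀ (Finset.mem_univ _)).symm
    rw [hL, hR]

end Truncate

variable {n m : ℕ}

/-- **`IsDegeneration q A B`** — `B` is a ONE-PARAMETER DEGENERATION OF DEPTH `≤ q` of `A` inside the determinant-preserving
gauge orbit closure: for some constant gauge `P, Q ∈ GL_m(ℂ)` and weights `a, b : Fin m → ℕ` bounded by `q` with `Σ a = Σ b`,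
the gauge form `P·A·Q` is block-lower-triangular for the weights and `B` is its weight-diagonal part — i.e.
`B = lim_{t→0} diag(t^a) · P A Q · diag(t^{-b})`, equivalently `B ≅ gr_F(A)` for a filtration `F` of the pencil `A` by
equal-dimension sub-pencils with `≤ q+1`… weight levels.  `q = 0`: `B` is a gauge form of `A` (`isDegeneration_zero_iff`).
[cite: King1994, §2, Prop. 3.1] [cite: KempfNess1979] -/
def IsDegeneration (q : ℕ∞) (A B : Matrix (Fin m) (Fin m) (MvPolynomial (Fin n × Fin n) ℂ)) : Prop :=
  ∃ (P Q : GL (Fin m) ℂ) (a b : Fin m → ℕ),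
    (∀ i, (a i : ℕ∞) ≤ q) ∧ (∀ j, (b j : ℕ∞) ≤ q) ∧ ∑ i, a i = ∑ j, b j ∧
    (∀ i j, a i < b j →
      ((P : Matrix (Fin m) (Fin m) ℂ).map C * A * (Q : Matrix (Fin m) (Fin m) ℂ).map C :
        Matrix (Fin m) (Fin m) (MvPolynomial (Fin n × Fin n) ℂ)) i j = 0) ∧
    B = weightTruncate a b
      ((P : Matrix (Fin m) (Fin m) ℂ).map C * A * (Q : Matrix (Fin m) (Fin m) ℂ).map C)

/-- Dial monotonicity: a depth-`q` degeneration is a depth-`q'` degeneration for `q ≤ q'`. [folklore] -/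
theorem IsDegeneration.mono {q q' : ℕ∞} (hq : q ≤ q') {A B : Matrix (Fin m) (Fin m) (MvPolynomial (Fin n × Fin n) ℂ)}
    (h : IsDegeneration q A B) : IsDegeneration q' A B := by
  obtain ⟨P, Q, a, b, ha, hb, hs, hz, hB⟩ := h
  exact ⟨P, Q, a, b, fun i => (ha i).trans hq, fun j => (hb j).trans hq, hs, hz, hB⟩

/-- **`q = 0` is gauge equivalence**: a depth-`0` degeneration of `A` is exactly a constant gauge form `P·A·Q`. [folklore] -/
theorem isDegeneration_zero_iff (A B : Matrix (Fin m) (Fin m) (MvPolynomial (Fin n × Fin n) ℂ)) :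
    IsDegeneration 0 A B ↔ ∃ P Q : GL (Fin m) ℂ,
      B = (P : Matrix (Fin m) (Fin m) ℂ).map C * A * (Q : Matrix (Fin m) (Fin m) ℂ).map C := by
  constructor
  · rintro ⟨P, Q, a, b, ha, hb, -, -, hB⟩
    have ha0 : a = fun _ => 0 := funext fun i => by exact_mod_cast nonpos_iff_eq_zero.mp (ha i)
    have hb0 : b = fun _ => 0 := funext fun j => by exact_mod_cast nonpos_iff_eq_zero.mp (hb j)
    subst ha0 hb0
    exact ⟨P, Q, by rw [hB, weightTruncate_zero]⟩
  · rintro ⟨P, Q, hB⟩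
    refine ⟨P, Q, fun _ => 0, fun _ => 0, fun _ => by simp, fun _ => by simp, rfl,
      fun i j h => (lt_irrefl _ h).elim, ?_⟩
    rw [weightTruncate_zero]; exact hB

/-- `A` is a depth-`0` degeneration of itself (`P = Q = 1`). [folklore] -/
theorem IsDegeneration.refl (A : Matrix (Fin m) (Fin m) (MvPolynomial (Fin n × Fin n) ℂ)) : IsDegeneration 0 A A :=
  (isDegeneration_zero_iff A A).mpr ⟨1, 1, by rw [Units.val_one (α := Matrix (Fin m) (Fin m) ℂ), Matrix.map_one C C_0 C_1, Matrix.one_mul, Matrix.mul_one]⟩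

/-- A degeneration of an affine matrix is affine (entries of `P A Q` are `ℂ`-combinations of entries of `A`; truncation keeps
entries or zeroes them). [folklore] -/
theorem IsDegeneration.totalDegree_le {q : ℕ∞} {A B : Matrix (Fin m) (Fin m) (MvPolynomial (Fin n × Fin n) ℂ)}
    (h : IsDegeneration q A B) {d : ℕ} (hA : ∀ i j, (A i j).totalDegree ≤ d) (i j : Fin m) : (B i j).totalDegree ≤ d := by
  obtain ⟨P, Q, a, b, -, -, -, -, rfl⟩ := h
  simp only [weightTruncate_apply]
  split_ifs
  · exact totalDegree_map_C_mul_mul_map_C_le _ _ hA i j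
  · simp

/-- **A degeneration has the same determinant up to a unit** (`det_weightTruncate` + `det (P A Q) = det P det Q · det A`).
[folklore] -/
theorem IsDegeneration.det_eq {q : ℕ∞} {A B : Matrix (Fin m) (Fin m) (MvPolynomial (Fin n × Fin n) ℂ)}
    (h : IsDegeneration q A B) : ∃ u : ℂ, u ≠ 0 ∧ B.det = C u * A.det := by
  obtain ⟨P, Q, a, b, -, -, hs, hz, rfl⟩ := h
  refine ⟨(P : Matrix (Fin m) (Fin m) ℂ).det * (Q : Matrix (Fin m) (Fin m) ℂ).det,
    mul_ne_zero (Matrix.isUnits_det_units P).ne_zero (Matrix.isUnits_det_units Q).ne_zero, ?_⟩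
  rw [det_weightTruncate a b _ hs hz, det_map_C_mul_mul_map_C]

/-- **Functoriality under substitution of variables**: a torus element `γ` (indeed any linear substitution) carries a
depth-`q` degeneration `A ⇝ B` to a depth-`q` degeneration `A(γ·x) ⇝ B(γ·x)` with the SAME gauge and weights (substitution
is a ring map on entries fixing constants). [folklore] -/
theorem IsDegeneration.linSubstEntries {q : ℕ∞} {A B : Matrix (Fin m) (Fin m) (MvPolynomial (Fin n × Fin n) ℂ)}
    (γ : GL (Fin n × Fin n) ℂ) (h : IsDegeneration q A B) :
    IsDegeneration q (Matrix.linSubstEntries γ A) (Matrix.linSubstEntries γ B) := by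
  obtain ⟨P, Q, a, b, ha, hb, hs, hz, rfl⟩ := h
  have hγ : Matrix.linSubstEntries γ
      ((P : Matrix (Fin m) (Fin m) ℂ).map C * A * (Q : Matrix (Fin m) (Fin m) ℂ).map C) =
      (P : Matrix (Fin m) (Fin m) ℂ).map C * Matrix.linSubstEntries γ A * (Q : Matrix (Fin m) (Fin m) ℂ).map C := by
    rw [Matrix.linSubstEntries_mul, Matrix.linSubstEntries_mul, Matrix.linSubstEntries_map_C,
      Matrix.linSubstEntries_map_C]
  refine ⟨P, Q, a, b, ha, hb, hs, fun i j hij => ?_, ?_⟩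
  · rw [← hγ, Matrix.linSubstEntries_apply, hz i j hij, map_zero]
  · rw [← hγ]
    simp only [Matrix.linSubstEntries]
    exact weightTruncate_map _ (map_zero _) a b _

/-- **`IsDegenerationClosed P`** — the constant gauge orbit of `P` is CLOSED UNDER ONE-PARAMETER DEGENERATION: every
degeneration of `P` (any depth) is again a gauge form of `P`.  For a pencil with `det ≢ 0` this says `P` is POLYSTABLE = a direct
sum of `θ`-stable pencils (every equal-dimension sub-pencil splits off), by the Hilbert–Mumford criterion / King.
(Named apart from the tree's `IsPolystable` of FORMS under `SL`, `Polystability.lean`.) [cite: King1994, Prop. 3.1, Thm. 4.1]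
[cite: KempfNess1979] -/
def IsDegenerationClosed (P : Matrix (Fin m) (Fin m) (MvPolynomial (Fin n × Fin n) ℂ)) : Prop :=
  ∀ B, IsDegeneration ⊤ P B → IsDegeneration 0 P B

/-- Degeneration-closedness is transported by substitution of variables (apply `γ⁻¹`, use closedness, apply `γ`). [folklore] -/
theorem IsDegenerationClosed.linSubstEntries {P : Matrix (Fin m) (Fin m) (MvPolynomial (Fin n × Fin n) ℂ)}
    (h : IsDegenerationClosed P) (γ : GL (Fin n × Fin n) ℂ) : IsDegenerationClosed (Matrix.linSubstEntries γ P) := by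
  intro B hB
  have h1 : IsDegeneration ⊤ P (Matrix.linSubstEntries γ⁻¹ B) := by
    have h0 := hB.linSubstEntries γ⁻¹
    rwa [Matrix.linSubstEntries_inv_linSubstEntries] at h0
  have h2 := (h _ h1).linSubstEntries γ
  rwa [Matrix.linSubstEntries_linSubstEntries, mul_inv_cancel, Matrix.linSubstEntries_one] at h2

/-! ## §2 Depth-`q` lifts and the graded covering family; the floor (`q = 0`), the rung (`q = 1`), the top (`q = ⊤`) -/

/-- **`DepthLifts q S A`** — every substitution `γ ∈ S` LIFTS UP TO DEPTH-`q` DEGENERATION: `A(γ·x)` and `A(x)` have a common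
depth-`q` one-parameter degeneration `B`.  At `q = 0` this is Landsberg–Ressayre's exact constant lift (`depthLifts_zero_iff`).
[cite: LandsbergRessayre2017, Def. 1.3] [cite: King1994, §2] -/
def DepthLifts (q : ℕ∞) (S : Set (GL (Fin n × Fin n) ℂ)) (A : Matrix (Fin m) (Fin m) (MvPolynomial (Fin n × Fin n) ℂ)) :
    Prop :=
  ∀ γ ∈ S, ∃ B, IsDegeneration q A B ∧ IsDegeneration q (Matrix.linSubstEntries γ A) B

/-- Dial monotonicity of the lift condition. [folklore] -/
theorem DepthLifts.mono {q q' : ℕ∞} (hq : q ≤ q') {S : Set (GL (Fin n × Fin n) ℂ)}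
    {A : Matrix (Fin m) (Fin m) (MvPolynomial (Fin n × Fin n) ℂ)} (h : DepthLifts q S A) : DepthLifts q' S A :=
  fun γ hγ => (h γ hγ).imp fun _ hB => ⟨hB.1.mono hq, hB.2.mono hq⟩

/-- Restricting the set of substitutions. [folklore] -/
theorem DepthLifts.subset {q : ℕ∞} {S S' : Set (GL (Fin n × Fin n) ℂ)} (hS : S' ⊆ S)
    {A : Matrix (Fin m) (Fin m) (MvPolynomial (Fin n × Fin n) ℂ)} (h : DepthLifts q S A) : DepthLifts q S' A :=
  fun γ hγ => h γ (hS hγ)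

/-- **`q = 0` IS the floor's lift condition**: depth-`0` lifts are exactly Landsberg–Ressayre's constant lifts
`A(γ·x) = g · A · h⁻¹`. [cite: LandsbergRessayre2017, Def. 1.3] -/
theorem depthLifts_zero_iff (S : Set (GL (Fin n × Fin n) ℂ)) (A : Matrix (Fin m) (Fin m) (MvPolynomial (Fin n × Fin n) ℂ)) :
    DepthLifts 0 S A ↔
      ∀ γ ∈ S, ∃ g h : GL (Fin m) ℂ,
        Matrix.linSubstEntries γ A =
          (g : Matrix (Fin m) (Fin m) ℂ).map C * A * ((h⁻¹ : GL (Fin m) ℂ) : Matrix (Fin m) (Fin m) ℂ).map C := by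
  constructor
  · intro hL γ hγ
    obtain ⟨B, hAB, hγB⟩ := hL γ hγ
    obtain ⟨P, Q, hB⟩ := (isDegeneration_zero_iff _ _).mp hAB
    obtain ⟨P', Q', hB'⟩ := (isDegeneration_zero_iff _ _).mp hγB
    refine ⟨P'⁻¹ * P, (Q * Q'⁻¹)⁻¹, ?_⟩
    rw [inv_inv, Units.val_mul, Units.val_mul, ← map_C_mul_baseChange, ← hB, hB',
      inv_map_C_mul_mul_map_C_inv]
  · intro hL γ hγ
    obtain ⟨g, h, e⟩ := hL γ hγ
    exact ⟨Matrix.linSubstEntries γ A, (isDegeneration_zero_iff _ _).mpr ⟨g, h⁻¹, e⟩, IsDegeneration.refl _⟩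

/-- **The graded family `DepthCovering q`** (degeneration depth `q ∈ ℕ∞`).  For `n ≥ 3`: every affine determinantal
representation `A` of `per_n` of size `m` whose substitutions by an admissibly cut subtorus `T_Λ` (`r` generators) lift UP TO
DEPTH-`q` DEGENERATION satisfies `C(n, ⌊n/2⌋) ≤ m · 2^r`.  The body is the floor `Theses.FreeSubtorus.SubtorusCovering` with
`IsEquivariantDetRepr` (exact lifts) replaced by `IsAffineDetRepr ∧ DepthLifts q`. [cite: LandsbergRessayre2017, Thm. 2.8, Question 2.2]
[cite: King1994, Thm. 4.1] -/
def DepthCovering (q : ℕ∞) : Prop :=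
  ∀ n : ℕ, 3 ≤ n → ∀ (m r : ℕ) (Λ : Fin r → (Fin n ⊕ Fin n) → ℤ)
    (A : Matrix (Fin m) (Fin m) (MvPolynomial (Fin n × Fin n) ℂ)),
    (∀ i, (∑ k, Λ i (Sum.inl k)) = 0 ∧ (∑ l, Λ i (Sum.inr l)) = 0) →
    IsAffineDetRepr (perPoly (Fin n) ℂ) A →
    DepthLifts q (subtorusGen n r Λ) A →
    Nat.choose n (n / 2) ≤ m * 2 ^ r

/-- **THE RUNG `FilteredCovering`** := `DepthCovering 1` — one move up from the floor: exact constant lifts ↦ lifts MODULO A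
ONE-STEP FILTRATION (two weight levels: `A(γ·x)` and `A(x)` become gauge equivalent after block-diagonalising each along one
equal-dimension sub-pencil).  For `n ≥ 3` such a representation of `per_n` of size `m` (`Λ` admissible, `r` generators) has
`C(n, ⌊n/2⌋) ≤ m · 2^r`. [cite: LandsbergRessayre2017, Question 2.2] [cite: King1994, Thm. 4.1] -/
def FilteredCovering : Prop := DepthCovering 1

/-- **THE TOP `PolystableCovering`** := `DepthCovering ⊤` — lifts modulo arbitrary finite filtrations (isomorphic Jordan–Hölder
semisimplifications of `A(γ·x)` and `A(x)`). [cite: King1994, Thm. 4.1] [cite: KempfNess1979] -/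
def PolystableCovering : Prop := DepthCovering ⊤

/-- Dial monotonicity (harder-to-easier): a smaller depth is a weaker rung. [folklore] -/
theorem DepthCovering.anti {q q' : ℕ∞} (hq : q ≤ q') (h : DepthCovering q') : DepthCovering q :=
  fun n hn m r Λ A hΛ hA hL => h n hn m r Λ A hΛ hA (hL.mono hq)

/-- The top implies every member, in particular the rung. [folklore] -/
theorem filteredCovering_of_polystableCovering (h : PolystableCovering) : FilteredCovering := h.anti le_top

/-- **`q = 0` IS the floor** (both directions: `Subgroup.subset_closure` one way, `IsEquivariantDetRepr.of_generators` the other).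
[cite: LandsbergRessayre2017, Def. 1.3, Thm. 2.8] -/
theorem depthCovering_zero_iff :
    DepthCovering 0 ↔ Summit.ValiantsHypothesis.ValiantsHypothesis.Theses.FreeSubtorus.SubtorusCovering := by
  constructor
  · intro hD n hn m r Λ B hΛ hB
    exact hD n hn m r Λ B hΛ hB.1
      ((depthLifts_zero_iff _ _).mpr fun γ hγ => hB.2 γ (Subgroup.subset_closure hγ))
  · intro hS n hn m r Λ A hΛ hA hL
    exact hS n hn m r Λ A hΛ (IsEquivariantDetRepr.of_generators hA ((depthLifts_zero_iff _ _).mp hL))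

/-- **The floor is proved** (seed g1-ValiantsHypothesis-16134, `subtorusCovering_proof`): `DepthCovering 0`.
[cite: LandsbergRessayre2017, Thm. 2.8] -/
theorem depthCovering_zero : DepthCovering 0 :=
  depthCovering_zero_iff.mpr
    Summit.ValiantsHypothesis.ValiantsHypothesis.Theorems.FreeSubtorusSubtorusCovering.subtorusCovering_proof

/-- Every member of the family implies the floor. [cite: LandsbergRessayre2017, Thm. 2.8] -/
theorem subtorusCovering_of_depthCovering {q : ℕ∞} (h : DepthCovering q) :
    Summit.ValiantsHypothesis.ValiantsHypothesis.Theses.FreeSubtorus.SubtorusCovering :=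
  depthCovering_zero_iff.mp (h.anti _root_.zero_le)

/-- The gauge-degree floor and the depth floor coincide (`GaugeCovering 0 ↔ DepthCovering 0`, both are the seed).
[cite: LandsbergRessayre2017, Def. 1.3] -/
theorem depthCovering_zero_iff_gaugeCovering_zero : DepthCovering 0 ↔ GaugeCovering 0 :=
  depthCovering_zero_iff.trans gaugeCovering_zero_iff.symm

/-! ## §3 The asymptotic shadow and the on-path lemma `S → shadow` -/

/-- **Asymptotic shadow of `DepthCovering q`.**  Along ANY sequence `(Λ_n, A_n)` of admissible lattice data and affine
determinantal representations `A_n` of `per_n` of sizes `m_n` (`n ≥ 3`) with depth-`q` lifts of the generators of `T_{Λ_n}`, the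
function `n ↦ m_n · 2^{r_n}` is not p-bounded. [cite: LandsbergRessayre2017, Question 2.2] -/
def DepthShadow (q : ℕ∞) : Prop :=
  ∀ (m r : ℕ → ℕ) (Λ : (n : ℕ) → Fin (r n) → (Fin n ⊕ Fin n) → ℤ)
    (A : (n : ℕ) → Matrix (Fin (m n)) (Fin (m n)) (MvPolynomial (Fin n × Fin n) ℂ)),
    (∀ n : ℕ, 3 ≤ n →
      (∀ i, (∑ k, Λ n i (Sum.inl k)) = 0 ∧ (∑ l, Λ n i (Sum.inr l)) = 0) ∧
      IsAffineDetRepr (perPoly (Fin n) ℂ) (A n) ∧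
      DepthLifts q (subtorusGen n (r n) (Λ n)) (A n)) →
    ¬ IsPBounded (fun n => m n * 2 ^ r n)

/-- **THE FILED RUNG DECLARATION `FilteredShadow`** — the asymptotic, fixed-`n`-free form of `FilteredCovering` (the summit is
asymptotic and symmetry-free, so this is the form it implies by name). [cite: LandsbergRessayre2017, Question 2.2] -/
def FilteredShadow : Prop := DepthShadow 1

/-- The top's shadow. [cite: King1994, Thm. 4.1] -/
def PolystableShadow : Prop := DepthShadow ⊤

/-- Dial monotonicity of the shadow. [folklore] -/
theorem DepthShadow.anti {q q' : ℕ∞} (hq : q ≤ q') (h : DepthShadow q') : DepthShadow q :=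
  fun m r Λ A hyp => h m r Λ A fun n hn => ⟨(hyp n hn).1, (hyp n hn).2.1, (hyp n hn).2.2.mono hq⟩

/-- A numeric member implies its shadow (`C(n,⌊n/2⌋)` is not p-bounded, tree `not_isPBounded_choose_middle`). [folklore] -/
theorem depthShadow_of_depthCovering {q : ℕ∞} (h : DepthCovering q) : DepthShadow q := by
  intro m r Λ A hyp hPB
  exact not_isPBounded_choose_middle (IsPBounded.of_eventually_le 3 hPB fun n hn =>
    h n hn (m n) (r n) (Λ n) (A n) (hyp n hn).1 (hyp n hn).2.1 (hyp n hn).2.2)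

/-- Rung (numeric) ⇒ rung (shadow). [folklore] -/
theorem filteredShadow_of_filteredCovering (h : FilteredCovering) : FilteredShadow :=
  depthShadow_of_depthCovering h

/-- `q = 0` of the shadow is gen 6's `GaugeShadow 0` (both are the floor's shadow). [cite: LandsbergRessayre2017, Def. 1.3] -/
theorem depthShadow_zero_iff_gaugeShadow_zero : DepthShadow 0 ↔ GaugeShadow 0 := by
  constructor
  · intro hD m r Λ B hyp
    exact hD m r Λ B fun n hn => ⟨(hyp n hn).1, (hyp n hn).2.1,
      (depthLifts_zero_iff _ _).mpr ((gaugeLifts_zero_iff _ _).mp (hyp n hn).2.2)⟩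
  · intro hG m r Λ B hyp
    exact hG m r Λ B fun n hn => ⟨(hyp n hn).1, (hyp n hn).2.1,
      (gaugeLifts_zero_iff _ _).mpr ((depthLifts_zero_iff _ _).mp (hyp n hn).2.2)⟩

/-- **`q = 0` of the shadow IS the floor's shadow** (gen 1's `CoveringShadow powLoss`). [cite: LandsbergRessayre2017, Thm. 2.8] -/
theorem depthShadow_zero_iff : DepthShadow 0 ↔ CoveringShadow powLoss :=
  depthShadow_zero_iff_gaugeShadow_zero.trans gaugeShadow_zero_iff

/-- The floor's parameter value of the shadow is a theorem (seed + `not_isPBounded_choose_middle`). [folklore] -/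
theorem depthShadow_zero : DepthShadow 0 :=
  depthShadow_of_depthCovering depthCovering_zero

/-- **ON-PATH LEMMA `S → shadow`** for EVERY depth: `VP_ℂ ≠ VNP_ℂ` implies `DepthShadow q`.  Only `dc(per_n) ≤ m_n` is used: a
p-bounded `dc(per)` makes `per` a `VP` family (`isVPFamily_of_isPBounded_determinantalComplexity`), hence `PER ∈ VP`, hence
`VP = VNP` (`perFamily_mem_VP_iff_VP_eq_VNP`, char `ℂ ≠ 2`). [cite: Burgisser2000, Thm. 2.10, §2.5] [cite: Valiant1979] -/
theorem depthShadow_of_summit (q : ℕ∞) (hS : _root_.ValiantsHypothesis) : DepthShadow q := by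
  intro m r Λ A hyp hPB
  have hdc : IsPBounded (fun n => determinantalComplexity (perPoly (Fin n) ℂ)) := by
    refine IsPBounded.of_eventually_le 3 hPB fun n hn => ?_
    have hrep : HasDetRepr (perPoly (Fin n) ℂ) (m n) := ⟨A n, (hyp n hn).2.1⟩
    calc determinantalComplexity (perPoly (Fin n) ℂ) ≤ m n := determinantalComplexity_le_of_hasDetRepr hrep
      _ = m n * 1 := (mul_one _).symm
      _ ≤ m n * 2 ^ r n := Nat.mul_le_mul_left _ Nat.one_le_two_pow
  have hι : IsPBounded (fun n => Fintype.card (Fin n × Fin n)) :=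
    (IsPBounded.mul_holds IsPBounded.id IsPBounded.id).mono fun n => by simp
  have hVP : IsVPFamily (fun n => perPoly (Fin n) ℂ) :=
    Summit.ValiantsHypothesis.Theorems.DeterminantalRigidityReductions.isVPFamily_of_isPBounded_determinantalComplexity
      hι hdc
  have hmem : perFamily ℂ ∈ VP ℂ := (mem_VP_ofFintype_iff_holds (fun n => perPoly (Fin n) ℂ)).2 hVP
  have hEq : VP ℂ = VNP ℂ := (perFamily_mem_VP_iff_VP_eq_VNP ℂ ringChar_complex_ne_two).1 hmem
  exact hS hEq

/-- **`S → Rung`**: `ValiantsHypothesis → FilteredShadow` (tagged for `aesop`). [cite: LandsbergRessayre2017, Question 2.2] -/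
@[aesop safe apply]
theorem filteredShadow_of_summit (hS : _root_.ValiantsHypothesis) : FilteredShadow :=
  depthShadow_of_summit 1 hS

/-- F4 name shape: `FilteredShadow_of_ValiantsHypothesis`. [cite: LandsbergRessayre2017, Question 2.2] -/
theorem FilteredShadow_of_ValiantsHypothesis : _root_.ValiantsHypothesis → FilteredShadow :=
  filteredShadow_of_summit

/-- `S → top shadow` as well. [cite: King1994, Thm. 4.1] -/
@[aesop safe apply]
theorem polystableShadow_of_summit (hS : _root_.ValiantsHypothesis) : PolystableShadow :=
  depthShadow_of_summit ⊤ hS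

/-- Rung (shadow) ⇒ floor's shadow. [folklore] -/
theorem powShadow_of_filteredShadow (h : FilteredShadow) : CoveringShadow powLoss :=
  depthShadow_zero_iff.mp (h.anti _root_.zero_le)

/-! ## §4 How the rung relaxes the open crux `OrbitDimensionBound` -/

/-- **`OrbitDepthBound q`** — the symmetrisation target RELAXED by the rung: for `n ≥ 3`, every affine determinantal
representation `A` of `per_n` of size `m` can be replaced by one, `B`, of the same size, whose generators of an admissibly cut
subtorus `T_Λ` with `r ≤ n/2` generators lift UP TO DEPTH-`q` DEGENERATION (the symmetriser may output a non-polystable matrix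
whose symmetry is visible only on an associated graded).  `q = 0` is implied by `OrbitDimensionBound`
(`orbitDepthBound_of_orbitDimensionBound`). [cite: LandsbergRessayre2017, Question 2.2] [cite: King1994, Thm. 4.1] -/
def OrbitDepthBound (q : ℕ∞) : Prop :=
  ∀ n : ℕ, 3 ≤ n → ∀ (m : ℕ) (A : Matrix (Fin m) (Fin m) (MvPolynomial (Fin n × Fin n) ℂ)),
    IsAffineDetRepr (perPoly (Fin n) ℂ) A →
    ∃ (B : Matrix (Fin m) (Fin m) (MvPolynomial (Fin n × Fin n) ℂ)) (r : ℕ) (Λ : Fin r → (Fin n ⊕ Fin n) → ℤ),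
      r ≤ n / 2 ∧
      (∀ i, (∑ k, Λ i (Sum.inl k)) = 0 ∧ (∑ l, Λ i (Sum.inr l)) = 0) ∧
      IsAffineDetRepr (perPoly (Fin n) ℂ) B ∧
      DepthLifts q (subtorusGen n r Λ) B

/-- The relaxed target is monotone in the depth (more depth allowed = weaker target). [folklore] -/
theorem OrbitDepthBound.mono {q q' : ℕ∞} (hq : q ≤ q') (h : OrbitDepthBound q) : OrbitDepthBound q' := by
  intro n hn m A hA
  obtain ⟨B, r, Λ, hr, hΛ, hB, hL⟩ := h n hn m A hA
  exact ⟨B, r, Λ, hr, hΛ, hB, hL.mono hq⟩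

/-- The host crux implies the relaxed target at every depth. [cite: LandsbergRessayre2017, Question 2.2] -/
theorem orbitDepthBound_of_orbitDimensionBound (q : ℕ∞)
    (h : Summit.ValiantsHypothesis.ValiantsHypothesis.Theses.FreeSubtorus.OrbitDimensionBound) : OrbitDepthBound q := by
  intro n hn m A hA
  obtain ⟨B, r, Λ, hr, hΛ, hB⟩ := h n hn m A hA
  refine ⟨B, r, Λ, hr, hΛ, hB.1, DepthLifts.mono _root_.zero_le ?_⟩
  exact (depthLifts_zero_iff _ _).mpr fun γ hγ => hB.2 γ (Subgroup.subset_closure hγ)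

/-- **The relaxed closing: `OrbitDepthBound q → DepthCovering q → ValiantsHypothesis`.**  An optimal expression `A` of `per_n`
exists (`hasDetRepr_determinantalComplexity_holds`); re-realise it at size `dc(per_n)` with depth-`q` symmetry under an admissible
`T_Λ`, `r ≤ n/2`; the member gives `C(n,⌊n/2⌋) ≤ dc(per_n) · 2^r ≤ dc(per_n) · 2^{⌊n/2⌋}`; gen 1's `vh_of_middle_bound` (the host
route's arithmetic + `expDcGlue_proof`) concludes. [cite: LandsbergRessayre2017, Thm. 2.8, Question 2.2] -/
theorem closes_depth {q : ℕ∞} (h₁ : OrbitDepthBound q) (h₂ : DepthCovering q) : _root_.ValiantsHypothesis := by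
  refine vh_of_middle_bound fun n hn => ?_
  obtain ⟨A, hA⟩ := hasDetRepr_determinantalComplexity_holds (perPoly (Fin n) ℂ)
  obtain ⟨B, r, Λ, hr, hΛ, hB, hL⟩ := h₁ n hn _ A hA
  calc Nat.choose n (n / 2) ≤ determinantalComplexity (perPoly (Fin n) ℂ) * 2 ^ r := h₂ n hn _ r Λ B hΛ hB hL
    _ ≤ determinantalComplexity (perPoly (Fin n) ℂ) * 2 ^ (n / 2) :=
        Nat.mul_le_mul_left _ (Nat.pow_le_pow_right (by norm_num) hr)

/-- The relaxed closing at the rung's own depth `q = 1`. [cite: LandsbergRessayre2017, Question 2.2] -/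
theorem closes_filtered (h₁ : OrbitDepthBound 1) (h₂ : FilteredCovering) : _root_.ValiantsHypothesis :=
  closes_depth h₁ h₂

/-- The relaxed closing at the top `q = ⊤` (the weakest symmetrisation target of the dial). [cite: King1994, Thm. 4.1] -/
theorem closes_polystable (h₁ : OrbitDepthBound ⊤) (h₂ : PolystableCovering) : _root_.ValiantsHypothesis :=
  closes_depth h₁ h₂

/-- For comparison: the host route's own closing from the floor, by name. [cite: LandsbergRessayre2017, Thm. 2.8] -/
theorem closes_floor (h₁ : Summit.ValiantsHypothesis.ValiantsHypothesis.Theses.FreeSubtorus.OrbitDimensionBound) :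
    _root_.ValiantsHypothesis :=
  Summit.ValiantsHypothesis.ValiantsHypothesis.Theses.FreeSubtorus.closes h₁ (subtorusCovering_of_depthCovering depthCovering_zero)

/-! ## §5 The dial is honest at both ends (kernel-checked sanity) -/

/-- Exact lifts are depth-`q` lifts for every `q` (the floor's hypothesis class sits inside every member's). [folklore] -/
theorem DepthLifts.of_exact {q : ℕ∞} {S : Set (GL (Fin n × Fin n) ℂ)}
    {A : Matrix (Fin m) (Fin m) (MvPolynomial (Fin n × Fin n) ℂ)}
    (h : ∀ γ ∈ S, ∃ g h : GL (Fin m) ℂ, Matrix.linSubstEntries γ A =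
      (g : Matrix (Fin m) (Fin m) ℂ).map C * A * ((h⁻¹ : GL (Fin m) ℂ) : Matrix (Fin m) (Fin m) ℂ).map C) :
    DepthLifts q S A :=
  ((depthLifts_zero_iff S A).mpr h).mono _root_.zero_le

/-- A `2 × 2` toy degeneration of depth `1` that is NOT a gauge form: the non-split pencil `[[X, 0], [1, X]]` (one variable
`X = x₀₀`, `n = 1`) degenerates, with weights `a = b = (0, 1)`, to the split pencil `[[X, 0], [0, X]]` — and the two are not
gauge equivalent (their constant parts have ranks `1` and `0`), so depth `1` strictly enlarges depth `0` already for `m = 2`.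
[cite: King1994, §2] -/
theorem depth_one_toy :
    IsDegeneration (n := 1) 1
      (!![X (0, 0), 0; 1, X (0, 0)] : Matrix (Fin 2) (Fin 2) (MvPolynomial (Fin 1 × Fin 1) ℂ))
      !![X (0, 0), 0; 0, X (0, 0)] ∧
    ¬ IsDegeneration (n := 1) 0
      (!![X (0, 0), 0; 1, X (0, 0)] : Matrix (Fin 2) (Fin 2) (MvPolynomial (Fin 1 × Fin 1) ℂ))
      !![X (0, 0), 0; 0, X (0, 0)] := by
  constructor
  · refine ⟨1, 1, ![0, 1], ![0, 1], ?_, ?_, rfl, ?_, ?_⟩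
    · intro i; fin_cases i <;> simp
    · intro j; fin_cases j <;> simp
    · intro i j hij
      rw [Units.val_one (α := Matrix (Fin 2) (Fin 2) ℂ), Matrix.map_one C C_0 C_1, Matrix.one_mul, Matrix.mul_one]
      fin_cases i <;> fin_cases j <;> simp_all
    · rw [Units.val_one (α := Matrix (Fin 2) (Fin 2) ℂ), Matrix.map_one C C_0 C_1, Matrix.one_mul, Matrix.mul_one]
      ext i j
      fin_cases i <;> fin_cases j <;> simp
  · intro h
    obtain ⟨P, Q, hPQ⟩ := (isDegeneration_zero_iff _ _).mp h
    -- compare constant parts: `0` on the left, `P · E₂₁ · Q` on the right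
    have key := congrArg (fun M : Matrix (Fin 2) (Fin 2) (MvPolynomial (Fin 1 × Fin 1) ℂ) =>
      M.map MvPolynomial.constantCoeff) hPQ
    have h1 : ∀ N : Matrix (Fin 2) (Fin 2) ℂ,
        (N.map (C : ℂ → MvPolynomial (Fin 1 × Fin 1) ℂ)).map MvPolynomial.constantCoeff = N := fun N => by
      ext i j; simp
    have hL : ((!![X (0, 0), 0; 0, X (0, 0)] : Matrix (Fin 2) (Fin 2) (MvPolynomial (Fin 1 × Fin 1) ℂ))).map
        MvPolynomial.constantCoeff = 0 := by
      ext i j; fin_cases i <;> fin_cases j <;> simp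
    have hM : ((!![X (0, 0), 0; 1, X (0, 0)] : Matrix (Fin 2) (Fin 2) (MvPolynomial (Fin 1 × Fin 1) ℂ))).map
        MvPolynomial.constantCoeff = !![0, 0; 1, 0] := by
      ext i j; fin_cases i <;> fin_cases j <;> simp
    simp only [Matrix.map_mul, h1, hL, hM] at key
    have hE := congrArg (fun M : Matrix (Fin 2) (Fin 2) ℂ =>
      ((P⁻¹ : GL (Fin 2) ℂ) : Matrix (Fin 2) (Fin 2) ℂ) * M * ((Q⁻¹ : GL (Fin 2) ℂ) : Matrix (Fin 2) (Fin 2) ℂ)) key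
    have hE' : (!![0, 0; 1, 0] : Matrix (Fin 2) (Fin 2) ℂ) = 0 := by
      simpa [Matrix.mul_assoc] using hE.symm
    have h10 := congrFun (congrFun hE' 1) 0
    simp at h10

end

end Summit.ValiantsHypothesis.ValiantsHypothesis.Cruxes.OrbitDimensionBound.Depth
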